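import Literature.Analysis.Convolution.OneSidedConvolutionPowers
import Mathlib.Analysis.Convolution
import Mathlib.Analysis.Calculus.ContDiff.Convolution
import Mathlib.Analysis.Calculus.ContDiff.Operations
import Mathlib.MeasureTheory.Measure.Haar.NormedSpace
import Mathlib.MeasureTheory.Measure.Haar.Unique
import Mathlib.MeasureTheory.Integral.IntervalIntegral.Basic
import HarnessLib

/-!
# One-sided convolution: smoothness, strict positivity, scaling, iterated products

Companion of `OneSidedConvolution.lean` / `OneSidedConvolutionPowers.lean` (the half-line
convolution `oconv f g x = ∫_{0<t≤x} f(t) g(x−t) dt`, the class `LocBdd`, powers `cpow`).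
Everything here is PROVED; nothing is re-proved from those files. New material:

* `oconv_eq_convolution` — for functions vanishing on `(−∞, 0]`, `oconv f g` IS Mathlib's
  two-sided convolution `f ⋆ g` (the integrand vanishes off `(0, x)`); through this bridge:
  `continuous_oconv`, `contDiff_oconv` (`f ∈ C^n` compactly supported, `g` continuous),
  `deriv_oconv` (`(f ⋆ g)' = f' ⋆ g`), from Mathlib's `HasCompactSupport.contDiff_convolution_left`
  / `hasDerivAt_convolution_left`;
* strict positivity `oconv_pos`, `cpow_pos` (`φ ≥ 0` continuous with `φ(c) > 0` gives
  `φ^{⋆n}(nc) > 0`), `hasCompactSupport_cpow`, `continuous_cpow`, `contDiff_cpow`;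
* the scaling operator `scaleFn κ f (w) = κ f(κ w)` and `oconv_scaleFn`:
  `S_κ f ⋆ S_κ g = S_κ (f ⋆ g)` (`κ > 0`), `cpow_scaleFn`;
* right-nested iterated products of a FAMILY `iterOconv n g = g 0 ⋆ (g 1 ⋆ (⋯ ⋆ g n))`
  (`g : Fin (n+1) → ℝ → ℝ`; for a constant family this is `cpow`, `iterOconv_const`), with
  `iterOconv_scaleFn`, local boundedness, support bands, a sup bound, continuity and `C¹`
  regularity with a derivative bound (`abs_deriv_iterOconv_le`).

These are the one-variable tools for product test functions `∏ u_i g_i(u_i)` in sums over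
products of primes (K. Ford, *On Bombieri's asymptotic sieve*, Trans. AMS 357 (2005), Lemma 2.2:
the main term is an iterated convolution at `1`, the induction step rescales by
`κ = log(x/p)/log x`), used in `Literature/NumberTheory/Sieve/FordAsymptoticSieve*.lean`.
-/

noncomputable section

namespace Literature.Analysis.Convolution

open MeasureTheory Set Finset
open scoped _root_.Convolution

/-! ### The bridge to Mathlib's two-sided convolution -/

section Bridge

variable {f g : ℝ → ℝ}

/-- For functions vanishing on `(−∞, 0]`, the one-sided convolution is Mathlib's convolution
`(f ⋆ g)(x) = ∫_ℝ f(t) g(x − t) dt`. [folklore] -/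
theorem oconv_eq_convolution (hf : ∀ t, t ≤ 0 → f t = 0) (hg : ∀ t, t ≤ 0 → g t = 0) (x : ℝ) :
    oconv f g x = (f ⋆ g) x := by
  rw [oconv_eq_integral_indicator, convolution_def]
  refine integral_congr_ae (Filter.Eventually.of_forall fun t => ?_)
  simp only [ContinuousLinearMap.lsmul_apply, smul_eq_mul]
  by_cases ht : t ∈ Set.Ioc 0 x
  · rw [Set.indicator_of_mem ht]
  · rw [Set.indicator_of_notMem ht]
    rw [Set.mem_Ioc, not_and_or, not_lt, not_le] at ht
    rcases ht with ht | ht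
    · rw [hf t ht, zero_mul]
    · rw [hg (x - t) (by linarith), mul_zero]

/-- Function-level form of `oconv_eq_convolution`. [folklore] -/
theorem oconv_eq_convolution' (hf : ∀ t, t ≤ 0 → f t = 0) (hg : ∀ t, t ≤ 0 → g t = 0) :
    oconv f g = f ⋆ g :=
  funext (oconv_eq_convolution hf hg)

/-- `f ⋆ g` is continuous for `f` continuous and `g` continuous with compact support (both
vanishing on `(−∞, 0]`). [folklore] -/
theorem continuous_oconv (hfc : Continuous f) (hf : ∀ t, t ≤ 0 → f t = 0) (hgc : Continuous g)
    (hcg : HasCompactSupport g) (hg : ∀ t, t ≤ 0 → g t = 0) : Continuous (oconv f g) := by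
  rw [oconv_eq_convolution' hf hg]
  exact hcg.continuous_convolution_right _ (hfc.locallyIntegrable (μ := volume)) hgc

/-- `f ⋆ g ∈ C^n` for `f ∈ C^n` with compact support and `g` continuous (both vanishing on
`(−∞, 0]`). [folklore] -/
theorem contDiff_oconv {n : ℕ∞} (hfc : ContDiff ℝ n f) (hcf : HasCompactSupport f)
    (hf : ∀ t, t ≤ 0 → f t = 0) (hgc : Continuous g) (hg : ∀ t, t ≤ 0 → g t = 0) :
    ContDiff ℝ n (oconv f g) := by
  rw [oconv_eq_convolution' hf hg]
  exact hcf.contDiff_convolution_left _ hfc (hgc.locallyIntegrable (μ := volume))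

/-- A `C¹` function vanishing on `(−∞, 0]` has derivative vanishing on `(−∞, 0]`. [folklore] -/
theorem deriv_eq_zero_of_nonpos (hfc : ContDiff ℝ 1 f) (hf : ∀ t, t ≤ 0 → f t = 0) {t : ℝ}
    (ht : t ≤ 0) : deriv f t = 0 := by
  -- `deriv f` is continuous and vanishes on the open half-line `(−∞, 0)`
  have hcont : Continuous (deriv f) := hfc.continuous_deriv le_rfl
  have hneg : ∀ s, s < 0 → deriv f s = 0 := by
    intro s hs
    have : f =ᶠ[nhds s] fun _ => 0 :=
      (eventually_lt_nhds hs).mono fun u hu => hf u hu.le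
    rw [this.deriv_eq, deriv_const]
  rcases lt_or_eq_of_le ht with h | h
  · exact hneg t h
  · subst h
    -- continuity at `0` from the left values
    have htend : Filter.Tendsto (deriv f) (nhdsWithin 0 (Set.Iio 0)) (nhds (deriv f 0)) :=
      hcont.continuousAt.continuousWithinAt.tendsto
    have hzero : Filter.Tendsto (deriv f) (nhdsWithin 0 (Set.Iio 0)) (nhds 0) := by
      refine tendsto_const_nhds.congr' ?_
      exact eventually_nhdsWithin_of_forall fun s hs => (hneg s hs).symm
    exact tendsto_nhds_unique htend hzero

/-- `(f ⋆ g)' = f' ⋆ g` for `f ∈ C¹` with compact support and `g` continuous (both vanishing on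
`(−∞, 0]`). [folklore] -/
theorem deriv_oconv (hfc : ContDiff ℝ 1 f) (hcf : HasCompactSupport f)
    (hf : ∀ t, t ≤ 0 → f t = 0) (hgc : Continuous g) (hg : ∀ t, t ≤ 0 → g t = 0) :
    deriv (oconv f g) = oconv (deriv f) g := by
  rw [oconv_eq_convolution' hf hg, oconv_eq_convolution' (fun t ht => deriv_eq_zero_of_nonpos hfc hf ht) hg]
  funext x
  exact (hcf.hasDerivAt_convolution_left _ hfc (hgc.locallyIntegrable (μ := volume)) x).deriv

/-- Strict positivity: `f, g ≥ 0` continuous with compact support, vanishing on `(−∞, 0]`,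
`f(c) > 0`, `g(c') > 0` give `(f ⋆ g)(c + c') > 0`. [folklore] -/
theorem oconv_pos (hfc : Continuous f) (hcf : HasCompactSupport f) (hf : ∀ t, t ≤ 0 → f t = 0)
    (hf0 : ∀ t, 0 ≤ f t) (hgc : Continuous g) (hg : ∀ t, t ≤ 0 → g t = 0) (hg0 : ∀ t, 0 ≤ g t)
    {c c' : ℝ} (hc : 0 < f c) (hc' : 0 < g c') : 0 < oconv f g (c + c') := by
  rw [oconv_eq_convolution hf hg, convolution_def]
  simp only [ContinuousLinearMap.lsmul_apply, smul_eq_mul]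
  have hcont : Continuous fun t => f t * g (c + c' - t) :=
    hfc.mul (hgc.comp (continuous_const.sub continuous_id))
  have hsupp : HasCompactSupport fun t => f t * g (c + c' - t) := hcf.mul_right
  refine hcont.integral_pos_of_hasCompactSupport_nonneg_nonzero hsupp
    (fun t => mul_nonneg (hf0 t) (hg0 _)) (x := c) ?_
  rw [show c + c' - c = c' by ring]
  exact (mul_pos hc hc').ne'

end Bridge

/-! ### Convolution powers: vanishing at `0`, compact support, continuity, smoothness, positivity -/

section Powers

variable {φ : ℝ → ℝ}

/-- If `φ = 0` on `(−∞, 0]` then so is every `φ^{⋆n}`. [folklore] -/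
theorem cpow_of_nonpos (hφ : ∀ t, t ≤ 0 → φ t = 0) : ∀ (n : ℕ) (x : ℝ), x ≤ 0 → cpow φ n x = 0
  | 0, _, _ => rfl
  | 1, x, hx => by rw [cpow_one]; exact hφ x hx
  | n + 2, x, hx => by rw [cpow_succ_succ]; exact oconv_of_nonpos hx _ _

/-- `φ^{⋆n}` has compact support if `φ` vanishes on `(−∞, 0]` and on `[c, ∞)`. [folklore] -/
theorem hasCompactSupport_cpow (hφ : ∀ t, t ≤ 0 → φ t = 0) {c : ℝ} (hc : ∀ t, c ≤ t → φ t = 0)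
    (n : ℕ) : HasCompactSupport (cpow φ n) := by
  refine HasCompactSupport.intro (isCompact_Icc (a := 0) (b := n * c)) fun x hx => ?_
  rw [Set.mem_Icc, not_and_or, not_le, not_le] at hx
  rcases Nat.eq_zero_or_pos n with rfl | hn
  · rfl
  rcases hx with hx | hx
  · exact cpow_of_nonpos hφ n x hx.le
  · exact cpow_eq_zero_of_le hc hn hx.le

/-- Continuity of the convolution powers of a continuous `φ` vanishing on `(−∞, 0]` and on
`[c, ∞)`. [folklore] -/
theorem continuous_cpow (hφc : Continuous φ) (hφ : ∀ t, t ≤ 0 → φ t = 0) {c : ℝ}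
    (hc : ∀ t, c ≤ t → φ t = 0) : ∀ n : ℕ, Continuous (cpow φ n)
  | 0 => continuous_const
  | 1 => by rw [cpow_one]; exact hφc
  | n + 2 => by
    rw [cpow_succ_succ]
    exact continuous_oconv hφc hφ (continuous_cpow hφc hφ hc (n + 1))
      (hasCompactSupport_cpow hφ hc (n + 1)) (cpow_of_nonpos hφ (n + 1))

/-- `φ^{⋆n} ∈ C^m` for `φ ∈ C^m` vanishing on `(−∞, 0]` and on `[c, ∞)` (`n ≥ 1`). [folklore] -/
theorem contDiff_cpow {m : ℕ∞} (hφc : ContDiff ℝ m φ) (hφ : ∀ t, t ≤ 0 → φ t = 0) {c : ℝ}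
    (hc : ∀ t, c ≤ t → φ t = 0) : ∀ n : ℕ, 1 ≤ n → ContDiff ℝ m (cpow φ n) := by
  intro n hn
  induction n, hn using Nat.le_induction with
  | base => rw [cpow_one]; exact hφc
  | succ k hk ih =>
    rw [cpow_succ φ hk]
    exact contDiff_oconv hφc (by simpa using hasCompactSupport_cpow hφ hc 1) hφ ih.continuous
      (cpow_of_nonpos hφ k)

/-- Strict positivity of convolution powers: `φ ≥ 0` continuous, vanishing on `(−∞, 0]` and on
`[c, ∞)`, `φ(c₀) > 0` give `φ^{⋆n}(n c₀) > 0` (`n ≥ 1`). [folklore] -/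
theorem cpow_pos (hφc : Continuous φ) (hφ : ∀ t, t ≤ 0 → φ t = 0) {c : ℝ}
    (hc : ∀ t, c ≤ t → φ t = 0) (hφ0 : ∀ t, 0 ≤ φ t) {c₀ : ℝ} (hc₀ : 0 < φ c₀) :
    ∀ n : ℕ, 1 ≤ n → 0 < cpow φ n (n * c₀) := by
  intro n hn
  induction n, hn using Nat.le_induction with
  | base => simpa using hc₀
  | succ k hk ih =>
    rw [cpow_succ φ hk, show ((k + 1 : ℕ) : ℝ) * c₀ = c₀ + k * c₀ by push_cast; ring]
    exact oconv_pos hφc (by simpa using hasCompactSupport_cpow hφ hc 1) hφ hφ0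
      (continuous_cpow hφc hφ hc k) (cpow_of_nonpos hφ k) (cpow_nonneg hφ0 k) hc₀ ih

end Powers

/-! ### Scaling -/

section Scaling

/-- The scaling operator `S_κ f (w) = κ f(κ w)`. [folklore] -/
def scaleFn (κ : ℝ) (f : ℝ → ℝ) : ℝ → ℝ := fun w => κ * f (κ * w)

/-- Unfolding `scaleFn`. [folklore] -/
theorem scaleFn_apply (κ : ℝ) (f : ℝ → ℝ) (w : ℝ) : scaleFn κ f w = κ * f (κ * w) := rfl

/-- **`S_κ f ⋆ S_κ g = S_κ (f ⋆ g)`** for `κ > 0` (the substitution `u = κ t` in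
`∫_0^w κf(κt) κg(κ(w−t)) dt`). [folklore] -/
theorem oconv_scaleFn {κ : ℝ} (hκ : 0 < κ) (f g : ℝ → ℝ) :
    oconv (scaleFn κ f) (scaleFn κ g) = scaleFn κ (oconv f g) := by
  funext w
  rcases le_or_gt w 0 with hw | hw
  · rw [oconv_of_nonpos hw, scaleFn_apply, oconv_of_nonpos (mul_nonpos_of_nonneg_of_nonpos hκ.le hw),
      mul_zero]
  rw [scaleFn_apply, oconv, oconv, ← intervalIntegral.integral_of_le hw.le,
    ← intervalIntegral.integral_of_le (mul_pos hκ hw).le]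
  simp only [scaleFn_apply]
  have h1 : ∀ t, κ * f (κ * t) * (κ * g (κ * (w - t))) =
      κ ^ 2 * ((fun u => f u * g (κ * w - u)) (κ * t)) := by
    intro t; simp only [mul_sub]; ring
  simp_rw [h1]
  rw [intervalIntegral.integral_const_mul]
  have h2 := intervalIntegral.integral_comp_mul_left (fun u => f u * g (κ * w - u)) hκ.ne'
    (a := 0) (b := w)
  simp only [mul_zero, smul_eq_mul] at h2
  rw [h2]
  field_simp

/-- Scaling commutes with convolution powers (`κ > 0`). [folklore] -/
theorem cpow_scaleFn {κ : ℝ} (hκ : 0 < κ) (f : ℝ → ℝ) :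
    ∀ n : ℕ, cpow (scaleFn κ f) n = scaleFn κ (cpow f n)
  | 0 => by funext w; simp [scaleFn_apply]
  | 1 => by simp
  | n + 2 => by rw [cpow_succ_succ, cpow_succ_succ, cpow_scaleFn hκ f (n + 1), oconv_scaleFn hκ]

end Scaling

/-! ### Iterated products of a family -/

section Iterated

/-- `iterOconv n g = g 0 ⋆ (g 1 ⋆ (⋯ ⋆ g n))` for a family `g : Fin (n+1) → (ℝ → ℝ)`.
[folklore] -/
def iterOconv : (n : ℕ) → (Fin (n + 1) → ℝ → ℝ) → ℝ → ℝ
  | 0, g => g 0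
  | n + 1, g => oconv (g 0) (iterOconv n (Fin.tail g))

/-- `iterOconv 0 g = g 0`. [folklore] -/
@[simp] theorem iterOconv_zero (g : Fin 1 → ℝ → ℝ) : iterOconv 0 g = g 0 := rfl

/-- `iterOconv (n+1) g = g 0 ⋆ iterOconv n (tail g)`. [folklore] -/
theorem iterOconv_succ (n : ℕ) (g : Fin (n + 2) → ℝ → ℝ) :
    iterOconv (n + 1) g = oconv (g 0) (iterOconv n (Fin.tail g)) := rfl

/-- Scaling commutes with iterated products (`κ > 0`). [folklore] -/
theorem iterOconv_scaleFn {κ : ℝ} (hκ : 0 < κ) :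
    ∀ (n : ℕ) (g : Fin (n + 1) → ℝ → ℝ),
      iterOconv n (fun i => scaleFn κ (g i)) = scaleFn κ (iterOconv n g)
  | 0, _ => rfl
  | n + 1, g => by
    rw [iterOconv_succ, iterOconv_succ]
    have : Fin.tail (fun i => scaleFn κ (g i)) = fun i => scaleFn κ (Fin.tail g i) := rfl
    rw [this, iterOconv_scaleFn hκ n (Fin.tail g), oconv_scaleFn hκ]

/-- The iterated product of a constant family is the convolution power. [folklore] -/
theorem iterOconv_const (ψ : ℝ → ℝ) : ∀ n : ℕ, iterOconv n (fun _ => ψ) = cpow ψ (n + 1)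
  | 0 => rfl
  | n + 1 => by
    rw [iterOconv_succ]
    have : Fin.tail (fun _ : Fin (n + 2) => ψ) = fun _ => ψ := rfl
    rw [this, iterOconv_const ψ n]; rfl

/-- `iterOconv (n+1) (g, ψ, …, ψ) = g ⋆ ψ^{⋆(n+1)}`. [folklore] -/
theorem iterOconv_cons_const (g ψ : ℝ → ℝ) (n : ℕ) :
    iterOconv (n + 1) (Fin.cons g fun _ => ψ) = oconv g (cpow ψ (n + 1)) := by
  rw [iterOconv_succ, Fin.cons_zero, Fin.tail_cons, iterOconv_const]

/-- Iterated products of locally bounded measurable functions are such. [folklore] -/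
theorem LocBdd.iterOconv : ∀ (n : ℕ) (g : Fin (n + 1) → ℝ → ℝ), (∀ i, LocBdd (g i)) →
    LocBdd (iterOconv n g)
  | 0, _, h => h 0
  | n + 1, g, h => (h 0).oconv (LocBdd.iterOconv n (Fin.tail g) fun _ => h _)

/-- Iterated products vanish on `(−∞, 0]` when the factors do. [folklore] -/
theorem iterOconv_of_nonpos : ∀ (n : ℕ) (g : Fin (n + 1) → ℝ → ℝ),
    (∀ i t, t ≤ 0 → g i t = 0) → ∀ x, x ≤ 0 → iterOconv n g x = 0
  | 0, _, h, x, hx => h 0 x hx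
  | n + 1, g, _, x, hx => by rw [iterOconv_succ]; exact oconv_of_nonpos hx _ _

/-- Lower support band: factors vanishing on `(−∞, ε)` give a product vanishing on
`(−∞, (n+1) ε)`. [folklore] -/
theorem iterOconv_eq_zero_of_lt {ε : ℝ} : ∀ (n : ℕ) (g : Fin (n + 1) → ℝ → ℝ),
    (∀ i t, t < ε → g i t = 0) → ∀ x, x < (n + 1) * ε → iterOconv n g x = 0
  | 0, g, h, x, hx => by rw [iterOconv_zero]; exact h 0 x (by simpa using hx)
  | n + 1, g, h, x, hx => by
    rw [iterOconv_succ]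
    refine oconv_eq_zero_of_lt (h 0) (iterOconv_eq_zero_of_lt n (Fin.tail g) fun i => h _) ?_
    push_cast at hx ⊢; linarith

/-- Upper support band: factors vanishing on `[T, ∞)` give a product vanishing on
`[(n+1) T, ∞)`. [folklore] -/
theorem iterOconv_eq_zero_of_le {T : ℝ} : ∀ (n : ℕ) (g : Fin (n + 1) → ℝ → ℝ),
    (∀ i t, T ≤ t → g i t = 0) → ∀ x, (n + 1) * T ≤ x → iterOconv n g x = 0
  | 0, g, h, x, hx => by rw [iterOconv_zero]; exact h 0 x (by simpa using hx)
  | n + 1, g, h, x, hx => by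
    rw [iterOconv_succ]
    refine oconv_eq_zero_of_le (h 0) (iterOconv_eq_zero_of_le n (Fin.tail g) fun i => h _) ?_
    push_cast at hx ⊢; linarith

/-- The sup bound `iterBound B T n` for `iterOconv n g` when `|g i| ≤ B` and the factors vanish
on `[T, ∞)`: `iterBound B T 0 = B`, `iterBound B T (n+1) = B · iterBound B T n · ((n+2) T)`.
[folklore] -/
def iterBound (B T : ℝ) : ℕ → ℝ
  | 0 => B
  | n + 1 => B * iterBound B T n * ((n + 2) * T)

/-- `iterBound B T n ≥ 0` for `B, T ≥ 0`. [folklore] -/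
theorem iterBound_nonneg {B T : ℝ} (hB : 0 ≤ B) (hT : 0 ≤ T) : ∀ n, 0 ≤ iterBound B T n
  | 0 => hB
  | n + 1 => by
    rw [iterBound]
    exact mul_nonneg (mul_nonneg hB (iterBound_nonneg hB hT n)) (by positivity)

/-- Sup bound for iterated products of functions bounded by `B` and vanishing on `[T, ∞)`
(`0 ≤ B`, `0 ≤ T`): `|iterOconv n g| ≤ iterBound B T n`. [folklore] -/
theorem abs_iterOconv_le {B T : ℝ} (hB : 0 ≤ B) (hT : 0 ≤ T) : ∀ (n : ℕ) (g : Fin (n + 1) → ℝ → ℝ),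
    (∀ i t, |g i t| ≤ B) → (∀ i t, T ≤ t → g i t = 0) →
    ∀ x, |iterOconv n g x| ≤ iterBound B T n
  | 0, g, hb, _, x => by simpa [iterBound] using hb 0 x
  | n + 1, g, hb, hT', x => by
    have ih := abs_iterOconv_le hB hT n (Fin.tail g) (fun i => hb _) (fun i => hT' _)
    have hBn : 0 ≤ iterBound B T n := iterBound_nonneg hB hT n
    rw [iterOconv_succ, iterBound]
    rcases le_or_gt x 0 with hx | hx
    · rw [oconv_of_nonpos hx, abs_zero]; positivity
    rcases le_or_gt ((n + 2 : ℝ) * T) x with hx2 | hx2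
    · rw [oconv_eq_zero_of_le (hT' 0) (iterOconv_eq_zero_of_le n (Fin.tail g) fun i => hT' _)
        (by linarith), abs_zero]
      positivity
    calc |oconv (g 0) (iterOconv n (Fin.tail g)) x|
        ≤ B * iterBound B T n * x :=
          abs_oconv_le hx.le (fun t _ => hb 0 t) (fun t _ => ih t) hB
      _ ≤ B * iterBound B T n * ((n + 2) * T) := by gcongr

/-- Compact support of iterated products (factors vanishing on `(−∞, 0]` and `[T, ∞)`). [folklore] -/
theorem hasCompactSupport_iterOconv {T : ℝ} (n : ℕ) (g : Fin (n + 1) → ℝ → ℝ)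
    (h0 : ∀ i t, t ≤ 0 → g i t = 0) (hT : ∀ i t, T ≤ t → g i t = 0) :
    HasCompactSupport (iterOconv n g) := by
  refine HasCompactSupport.intro (isCompact_Icc (a := 0) (b := (n + 1) * T)) fun x hx => ?_
  rw [Set.mem_Icc, not_and_or, not_le, not_le] at hx
  rcases hx with hx | hx
  · exact iterOconv_of_nonpos n g h0 x hx.le
  · exact iterOconv_eq_zero_of_le n g hT x hx.le

/-- Continuity of iterated products of continuous factors vanishing on `(−∞, 0]` and
`[T, ∞)`. [folklore] -/
theorem continuous_iterOconv {T : ℝ} : ∀ (n : ℕ) (g : Fin (n + 1) → ℝ → ℝ),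
    (∀ i, Continuous (g i)) → (∀ i t, t ≤ 0 → g i t = 0) → (∀ i t, T ≤ t → g i t = 0) →
    Continuous (iterOconv n g)
  | 0, _, hc, _, _ => hc 0
  | n + 1, g, hc, h0, hT => by
    rw [iterOconv_succ]
    exact continuous_oconv (hc 0) (h0 0)
      (continuous_iterOconv n (Fin.tail g) (fun i => hc _) (fun i => h0 _) (fun i => hT _))
      (hasCompactSupport_iterOconv n (Fin.tail g) (fun i => h0 _) (fun i => hT _))
      (iterOconv_of_nonpos n (Fin.tail g) fun i => h0 _)

/-- `C¹` regularity of iterated products: it suffices that the FIRST factor is `C¹` with compact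
support (the others continuous), all vanishing on `(−∞, 0]` and `[T, ∞)`. [folklore] -/
theorem contDiff_iterOconv {T : ℝ} (n : ℕ) (g : Fin (n + 1) → ℝ → ℝ)
    (hd : ContDiff ℝ 1 (g 0)) (hcs : HasCompactSupport (g 0)) (hc : ∀ i, Continuous (g i))
    (h0 : ∀ i t, t ≤ 0 → g i t = 0) (hT : ∀ i t, T ≤ t → g i t = 0) :
    ContDiff ℝ 1 (iterOconv n g) := by
  cases n with
  | zero => exact hd
  | succ n =>
    rw [iterOconv_succ]
    exact contDiff_oconv hd hcs (h0 0)
      (continuous_iterOconv n (Fin.tail g) (fun i => hc _) (fun i => h0 _) (fun i => hT _))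
      (iterOconv_of_nonpos n (Fin.tail g) fun i => h0 _)

/-- Derivative bound for iterated products: with `|g i| ≤ B`, `|(g 0)'| ≤ B'`, factors vanishing
on `(−∞, 0]` and `[T, ∞)` (`0 ≤ B, B', T`),
`|(iterOconv (n+1) g)'| ≤ B' · iterBound B T n · ((n+2) T)`. [folklore] -/
theorem abs_deriv_iterOconv_le {B B' T : ℝ} (hB : 0 ≤ B) (hB' : 0 ≤ B') (hTn : 0 ≤ T) (n : ℕ)
    (g : Fin (n + 2) → ℝ → ℝ) (hd : ContDiff ℝ 1 (g 0)) (hcs : HasCompactSupport (g 0))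
    (hc : ∀ i, Continuous (g i)) (h0 : ∀ i t, t ≤ 0 → g i t = 0) (hT : ∀ i t, T ≤ t → g i t = 0)
    (hb : ∀ i t, |g i t| ≤ B) (hb' : ∀ t, |deriv (g 0) t| ≤ B') (x : ℝ) :
    |deriv (iterOconv (n + 1) g) x| ≤ B' * iterBound B T n * ((n + 2) * T) := by
  have hG := abs_iterOconv_le hB hTn n (Fin.tail g) (fun i => hb _) (fun i => hT _)
  rw [iterOconv_succ, deriv_oconv hd hcs (h0 0)
    (continuous_iterOconv n (Fin.tail g) (fun i => hc _) (fun i => h0 _) (fun i => hT _))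
    (iterOconv_of_nonpos n (Fin.tail g) fun i => h0 _)]
  have hBn : 0 ≤ iterBound B T n := iterBound_nonneg hB hTn n
  rcases le_or_gt x 0 with hx | hx
  · rw [oconv_of_nonpos hx, abs_zero]; positivity
  rcases le_or_gt x ((n + 2) * T) with hx2 | hx2
  · calc |oconv (deriv (g 0)) (iterOconv n (Fin.tail g)) x|
          ≤ B' * iterBound B T n * x :=
            abs_oconv_le hx.le (fun t _ => hb' t) (fun t _ => hG t) hB'
        _ ≤ B' * iterBound B T n * ((n + 2) * T) := by gcongr
  · -- for `x > (n+2)T` the integrand `g₀'(t) G(x − t)` vanishes: either `t > T` (where `g₀' = 0`,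
    -- as `g₀ = 0` on the open set `(T, ∞)`) or `x − t ≥ (n+1)T` (where `G = 0`).
    have hderiv0 : ∀ t, T < t → deriv (g 0) t = 0 := by
      intro t ht
      have : g 0 =ᶠ[nhds t] fun _ => 0 :=
        (eventually_gt_nhds ht).mono fun u hu => hT 0 u hu.le
      rw [this.deriv_eq, deriv_const]
    rw [oconv, setIntegral_congr_fun measurableSet_Ioc (g := fun _ => (0 : ℝ)) ?_, integral_zero,
      abs_zero]
    · positivity
    intro t _
    by_cases h1 : T < t
    · simp [hderiv0 t h1]
    · have : (n + 1 : ℝ) * T ≤ x - t := by linarith [not_lt.1 h1]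
      simp [iterOconv_eq_zero_of_le n (Fin.tail g) (fun i => hT _) (x - t) this]

end Iterated

end Literature.Analysis.Convolution
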